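import Summits.CriticalPhenomena.Ising3D.Control2DL19BoxWTable
import Mathlib.Tactic.NormNum
import HarnessLib

/-!
# RB-2 certificate `j136729_functional_deriv2d_L19_E048_sig1o8_box0.98-0.985.json` (Λ = 19, E₀ = 48): Δ_ε ∉ [49/50, 197/200] at Δ_σ = 1/8 under A2D′ — (R), the large-`S` half, in the kernel
(cell `pub-ising3x`, seat controls-1 gen 19; KERNEL PATH for the 2D γ-certificates, Λ = 19 — CONTROL-ONLY)

HONEST FRAMING: lottery ticket; floor = tightest certified 3D Ising CFT bounds; no exact-solution
claim without a proof. CONTROL-ONLY (`d = 2`, `Δ_σ = 1/8`, the 2D Ising control; axiom set `A2D′`).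

(R) for the table `wtboxW` (`Control2DL19BoxWTable`), kernel data only: the compactified region polynomial `QhatboxW`
(`S₁ = 96`, `d = 19`) is non-negative on `τ ∈ [0,1]`, `v ∈ [0,1]` by the tensor-Bernstein SHAPE tree `cregboxW`
(3 leaves; every Bernstein coefficient computed and decided in the kernel, `Control2DPolyCertAuto2`, in 1 chunks of
≤ 12 leaves re-assembled along the splits), and `S ≤ S₁` by the per-`J` shapes `cregJboxW` of the Table file;
the root fact `cregboxW_n0` and the per-`J` fact `cregJboxW_ok` are turned into hypothesis `hR` by `region_of_kernelCertAuto` INSIDE the assembly file `Control2DL19BoxW` (no standalone `region_boxW` theorem: its statement would coincide, up to the table's name, with the other Λ = 19 boxes' — gate dedup lint, controls-1 g17). No facts, standard axioms only.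
-/

namespace Summit.CriticalPhenomena.Ising3D.Control2D

open Literature.MathematicalPhysics.QuantumFieldTheory.ConformalBootstrap3D

set_option maxHeartbeats 0 in
set_option maxRecDepth 200000 in
/-- Chunk 0 of the large-`S` tree (box `q₁=1, a₁=0; q₂=1, a₂=0`; 3 leaves), decided in the kernel. [folklore] -/
theorem cregboxW_n0 :
    checkAuto₂ QhatboxW 20 1 0 1 1 0 1
    (Shape₂.splitO (Shape₂.leaf) (Shape₂.splitI (Shape₂.leaf) (Shape₂.leaf))) = true := by
  decide +kernel

end Summit.CriticalPhenomena.Ising3D.Control2D
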